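import Summits.ValiantsHypothesis.ValiantsHypothesis.Theses.UlrichPadded
import Summits.ValiantsHypothesis.ValiantsHypothesis.Theorems.HubHub

/-!
# Route UlrichPadded — item `Assembly`

Item `stmt-ValiantsHypothesis-5672` (assembly of route `UlrichPadded`): pure bookkeeping.
Given (1) "every `VP` family has quasi-polynomially bounded determinantal complexity"
(Bürgisser–Clausen–Shokrollahi 1997, Cor. (21.40); in tree as
`Literature.Computability.AlgebraicComplexity.isQPBounded_determinantalComplexity_of_isVPFamily_holds`,
but taken here as a hypothesis exactly as the route decl states it), (2) the route target
`Target` ("`dc(per_n)` over `ℂ` is not quasi-polynomially bounded"), (3) the renaming bridge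
`perFamily ℂ ∈ VP ℂ ↔ IsVPFamily (fun n => perPoly (Fin n) ℂ)` and (4) Valiant's
`perFamily ℂ ∈ VNP ℂ`, conclude `ValiantsHypothesis` (`VP ℂ ≠ VNP ℂ`).
Proof: by (1) and (2) the permanent family is not a `VP` family; the landed hub lemma
`Summit.ValiantsHypothesis.Hub.valiantsHypothesis_of_not_isVPFamily_per` (Theorems/HubHub.lean)
turns this, the bridge and `per ∈ VNP` into `VP ℂ ≠ VNP ℂ`.
-/

namespace Summit.ValiantsHypothesis.Theorems

open Literature.Computability.AlgebraicComplexity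

/-- **Assembly** (route UlrichPadded, item `stmt-ValiantsHypothesis-5672`):
(VP ⇒ qp-bounded dc) → Target → (renaming bridge for the permanent family) → per ∈ VNP →
`ValiantsHypothesis`. Bookkeeping: the first two hypotheses say the permanent family over `ℂ` is
not a `VP` family, and the hub lemma `valiantsHypothesis_of_not_isVPFamily_per` finishes.
[folklore] -/
theorem ulrichPadded_assembly_proof :
    Summit.ValiantsHypothesis.ValiantsHypothesis.Theses.UlrichPadded.Assembly := by
  unfold Summit.ValiantsHypothesis.ValiantsHypothesis.Theses.UlrichPadded.Assembly
  intro hVP hTarget hbridge hVNP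
  refine Summit.ValiantsHypothesis.Hub.valiantsHypothesis_of_not_isVPFamily_per ?_ hbridge hVNP
  intro hper
  exact hTarget (hVP _ hper)

end Summit.ValiantsHypothesis.Theorems
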